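import Summits.CriticalPhenomena.PercolationContinuityZ3.Theorems.PercNearOneGluingNoHeavyRsw3InvasionEquivariance
import HarnessLib

/-!
# RSW3 lane (P2, gen 29): INVASION PERCOLATION XXXVIII — Lyons–Peres–Schramm 2006 PROPOSITION 3.4 (tree form): the invasion trees of the two
# endpoints of a WMSF bond COINCIDE up to finitely many bonds (every infinite connected locally finite graph, injective labels); a.s. on `ℤ^d`

builds on p205010 (kernel theorem, internal audit signed; external expert review pending) — NOT used in this file.

Cell `prim-rsw3`, prover seat `prim-rsw3-p2` (gen 29), memo `run/shared/lean/prim/rsw3/P2-RSWLITE.md` §36.  Support file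
(`--supports stmt-CriticalPhenomena-4575`); no definitions, no named facts, no sorries.  The strict-level configuration `{f ∈ E(G) : U f < t}` is written
inline; `C_{<t}(v)` denotes its open cluster.

LPS06, Prop. 3.4: "If `x` and `y` are vertices in the same component of `𝔉_w(U)`, then … `T_U(x) △ T_U(y)` [is] finite."  Proof (LPS, for `e = [x, y] ∈ 𝔉_w`):
"Consider `C(x)`, `C(y)` in `G[U(e)]`.  Not both can be infinite, since `e ∈ 𝔉_w`.  If both are finite, then invasion from each `x` and `y` will fill
`C(x) ∪ C(y) ∪ {e}` before invading elsewhere … if `C(x)` is finite and `C(y)` infinite, then `I(x) = C(x) ∪ {e} ∪ I(y)`."  Kernel version: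

* §1 strict-level tools: `acceptedLabel_lt_of_ltCluster_not_subset` (cluster-absorption priority at strict level), `coe_invasion_subset_ltCluster`,
  **`invasion_eq_ltCluster`** (a finite strict cluster `C_{<t}(o)` is filled first: `I_c = C_{<t}(o)`, all earlier labels `< t`), `newDart_ltCluster_exit`
  (the exit dart from a filled finite `C_{<U e}(x)` not containing `y` is `(x', y')` = the bond `e` itself when `e = s(x, y)` is its least boundary bond).
* §2 `iterate_step_union` — THE MIRROR LEMMA: a finite set `D` all of whose outgoing bonds have label `≥ t` is invisible to an invasion that keeps accepting
  labels `< t`: `step^[n] (D ∪ A) = D ∪ step^[n] A` with the same absorbed darts.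
* §3 (first half) `ltCluster_subset_of_least_boundary` (the inner endpoint of a WMSF bond has a finite strict cluster), **`treeEdges_of_ltCluster_infinite`** (case
  "`C(y)` infinite": `T(y) ⊆ T(x)` and `T(x) ∖ T(y)` among the first `|C(x)|` bonds of `x`).  The case "both clusters finite" (`T(x) = T(y)`), the finiteness of
  `T(x) △ T(y)` for every WMSF bond and along WMSF paths, and the `ℤ^d` a.s. form are in the companion file `…Rsw3InvasionWMSFNeighboursFinite.lean`.

References: R. Lyons, Y. Peres, O. Schramm, Ann. Probab. 34 (2006) 1665–1692, Prop. 3.4 [LyonsPeresSchramm2006]; K. S. Alexander, Ann. Probab. 23 (1995) (ℤ^d).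
-/

noncomputable section

namespace Summit.CriticalPhenomena.PercolationContinuityZ3.Theorems.Rsw3

open Finset Filter MeasureTheory Literature.Probability.LatticeModels Literature.Probability.Percolation Literature.Probability.Percolation.Invasion

section General

variable {V : Type*} [DecidableEq V] {G : SimpleGraph V} [G.LocallyFinite]

/-! ## §1 Strict-level clusters and the invasion -/

omit [DecidableEq V] [G.LocallyFinite] in
/-- The strict-level open graph is a subgraph of `G`. [folklore] -/
theorem openGraph_ltCfg_le (U : Sym2 V → ℝ) (t : ℝ) : openGraph {f : Sym2 V | f ∈ G.edgeSet ∧ U f < t} ≤ G := by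
  intro u v h
  exact ((openGraph_adj _ u v).1 h).1.1

/-- **Cluster-absorption priority at a strict level**: if some vertex of the strict cluster `C_{<t}(u)` of an invaded vertex `u` is not yet invaded, the accepted
label is `< t`. [cite: ChayesChayesNewman1985, §3 (ii) (clusters are absorbed whole)] -/
theorem acceptedLabel_lt_of_ltCluster_not_subset {U : Sym2 V → ℝ} {o : V} {n : ℕ} {t : ℝ} {u v : V} (hu : u ∈ invasion G U o n)
    (hv : v ∈ openCluster {f : Sym2 V | f ∈ G.edgeSet ∧ U f < t} u) (hvI : v ∉ invasion G U o n) : acceptedLabel G U o n < t := by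
  obtain ⟨b, hb, hadj⟩ := exists_boundaryDart_of_reachable (openGraph_ltCfg_le U t) hv hu hvI
  have hlt : U s(b.1, b.2) < t := ((openGraph_adj _ _ _).1 hadj).1.2
  exact (acceptedLabel_le_of_mem_boundaryDarts hb).trans_lt hlt

/-- While all accepted labels are `< t`, the invaded region stays in the strict cluster `C_{<t}(o)`. [cite: ChayesChayesNewman1985, §3 (ii)] -/
theorem coe_invasion_subset_ltCluster {U : Sym2 V → ℝ} {o : V} {t : ℝ} :
    ∀ {n : ℕ}, (∀ k < n, acceptedLabel G U o k < t) → (↑(invasion G U o n) : Set V) ⊆ openCluster {f : Sym2 V | f ∈ G.edgeSet ∧ U f < t} o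
  | 0, _ => by
    intro v hv
    rw [Finset.mem_coe, invasion_zero, mem_singleton] at hv
    rw [hv]; exact mem_openCluster_self _ _
  | n + 1, h => by
    intro v hv
    rw [Finset.mem_coe, invasion_succ] at hv
    cases hd : newDart G U (invasion G U o n) with
    | none =>
      rw [step_of_eq_none G hd] at hv
      exact coe_invasion_subset_ltCluster (fun k hk => h k (Nat.lt_succ_of_lt hk)) (Finset.mem_coe.2 hv)
    | some a =>
      rw [step_of_eq_some G hd, mem_insert] at hv
      rcases hv with rfl | hv
      · have h1 : a.1 ∈ openCluster {f : Sym2 V | f ∈ G.edgeSet ∧ U f < t} o :=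
          coe_invasion_subset_ltCluster (fun k hk => h k (Nat.lt_succ_of_lt hk)) (Finset.mem_coe.2 (fst_mem_of_newDart hd))
        have hlt : U s(a.1, a.2) < t := by rw [← acceptedLabel_of_eq_some G hd]; exact h n (Nat.lt_succ_self n)
        have hadj' : (openGraph {f : Sym2 V | f ∈ G.edgeSet ∧ U f < t}).Adj a.1 a.2 :=
          (openGraph_adj {f : Sym2 V | f ∈ G.edgeSet ∧ U f < t} a.1 a.2).2 ⟨⟨adj_of_newDart hd, hlt⟩, (adj_of_newDart hd).ne⟩
        exact SimpleGraph.Reachable.trans h1 hadj'.reachable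
      · exact coe_invasion_subset_ltCluster (fun k hk => h k (Nat.lt_succ_of_lt hk)) (Finset.mem_coe.2 hv)

/-- **A finite strict cluster is filled first**: if `C_{<t}(o)` is finite with `c + 1` vertices, then for every `n ≤ c` the invaded region `I_n` lies in it and all
labels accepted before time `n` are `< t`; in particular `I_c = C_{<t}(o)`. [cite: LyonsPeresSchramm2006, Prop. 3.4 (proof: "invasion … will fill C(x) … before invading elsewhere")] -/
theorem invasion_subset_ltCluster_and_lt [Infinite V] (hG : G.Preconnected) {U : Sym2 V → ℝ} {o : V} {t : ℝ} {c : ℕ}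
    (hfin : (openCluster {f : Sym2 V | f ∈ G.edgeSet ∧ U f < t} o).Finite) (hcard : hfin.toFinset.card = c + 1) :
    ∀ n, n ≤ c → (↑(invasion G U o n) : Set V) ⊆ openCluster {f : Sym2 V | f ∈ G.edgeSet ∧ U f < t} o ∧ ∀ k < n, acceptedLabel G U o k < t := by
  intro n
  induction n with
  | zero => exact fun _ => ⟨coe_invasion_subset_ltCluster (fun k hk => absurd hk (Nat.not_lt_zero k)), fun k hk => absurd hk (Nat.not_lt_zero k)⟩
  | succ n ih =>
    intro hn
    obtain ⟨hsub, hlt⟩ := ih (Nat.le_of_succ_le hn)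
    -- `I_n ⊊ C`, so some cluster vertex is not invaded and the label accepted at time `n` is `< t`
    have hcardn : (invasion G U o n).card = n + 1 := card_invasion hG U o n
    have hne : ∃ v ∈ openCluster {f : Sym2 V | f ∈ G.edgeSet ∧ U f < t} o, v ∉ invasion G U o n := by
      by_contra h
      push Not at h
      have hsub' : hfin.toFinset ⊆ invasion G U o n := fun v hv => h v (hfin.mem_toFinset.1 hv)
      have := card_le_card hsub'
      omega
    obtain ⟨v, hv, hvI⟩ := hne
    have hn' : acceptedLabel G U o n < t := acceptedLabel_lt_of_ltCluster_not_subset (root_mem_invasion U o n) hv hvI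
    have hall : ∀ k < n + 1, acceptedLabel G U o k < t := fun k hk => by
      rcases Nat.lt_succ_iff_lt_or_eq.1 hk with hk | rfl
      · exact hlt k hk
      · exact hn'
    exact ⟨coe_invasion_subset_ltCluster hall, hall⟩

/-- **The finite strict cluster is exactly the invaded region at time `c`.** [cite: LyonsPeresSchramm2006, Prop. 3.4 (proof)] -/
theorem coe_invasion_eq_ltCluster [Infinite V] (hG : G.Preconnected) {U : Sym2 V → ℝ} {o : V} {t : ℝ} {c : ℕ}
    (hfin : (openCluster {f : Sym2 V | f ∈ G.edgeSet ∧ U f < t} o).Finite) (hcard : hfin.toFinset.card = c + 1) :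
    (↑(invasion G U o c) : Set V) = openCluster {f : Sym2 V | f ∈ G.edgeSet ∧ U f < t} o := by
  obtain ⟨hsub, -⟩ := invasion_subset_ltCluster_and_lt hG hfin hcard c le_rfl
  refine Set.eq_of_subset_of_ncard_le hsub ?_ hfin
  rw [Set.ncard_coe_finset, card_invasion hG U o c, Set.ncard_eq_toFinset_card _ hfin, hcard]

omit [DecidableEq V] [G.LocallyFinite] in
/-- Bonds leaving a strict cluster have label `≥ t`. [folklore] -/
theorem le_label_of_mem_ltCluster_of_not_mem {U : Sym2 V → ℝ} {o : V} {t : ℝ} {d w : V}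
    (hd : d ∈ openCluster {f : Sym2 V | f ∈ G.edgeSet ∧ U f < t} o) (hw : w ∉ openCluster {f : Sym2 V | f ∈ G.edgeSet ∧ U f < t} o)
    (hadj : G.Adj d w) : t ≤ U s(d, w) := by
  by_contra hlt
  push Not at hlt
  have hadj' : (openGraph {f : Sym2 V | f ∈ G.edgeSet ∧ U f < t}).Adj d w :=
    (openGraph_adj {f : Sym2 V | f ∈ G.edgeSet ∧ U f < t} d w).2 ⟨⟨hadj, hlt⟩, hadj.ne⟩
  exact hw (SimpleGraph.Reachable.trans hd hadj'.reachable)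

/-- **The exit dart.**  Injective labels, `e = s(x, y)` a bond with `y ∉ C_{<U e}(x)` and `C_{<U e}(x)` finite of size `c + 1`: at time `c` the invasion from `x` absorbs
exactly the dart `(x, y)` (all boundary bonds of the filled cluster have label `≥ U e`, and `e` is the unique one with label `U e`).
[cite: LyonsPeresSchramm2006, Prop. 3.4 (proof)] -/
theorem newDart_ltCluster_exit [Infinite V] (hG : G.Preconnected) {U : Sym2 V → ℝ} (hU : Function.Injective U) {x y : V} (hxy : G.Adj x y)
    (hy : y ∉ openCluster {f : Sym2 V | f ∈ G.edgeSet ∧ U f < U s(x, y)} x) {c : ℕ}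
    (hfin : (openCluster {f : Sym2 V | f ∈ G.edgeSet ∧ U f < U s(x, y)} x).Finite) (hcard : hfin.toFinset.card = c + 1) :
    newDart G U (invasion G U x c) = some (x, y) := by
  have hI := coe_invasion_eq_ltCluster hG hfin hcard
  refine newDart_eq_some_of_mem_minDarts hU.injOn ((mem_minDarts G).2 ⟨?_, fun b hb => ?_⟩)
  · exact (mem_boundaryDarts G).2 ⟨root_mem_invasion U x c, fun h => hy (hI ▸ Finset.mem_coe.2 h), hxy⟩
  · obtain ⟨hb1, hb2, hbadj⟩ := (mem_boundaryDarts G).1 hb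
    exact le_label_of_mem_ltCluster_of_not_mem (hI ▸ Finset.mem_coe.2 hb1) (fun h => hb2 (Finset.mem_coe.1 (hI.symm ▸ h))) hbadj

/-! ## §2 The mirror lemma -/

/-- `I_{m+n}` is the `n`-th iterate of `step` from `I_m`. [cite: ChayesChayesNewman1985, §2 (the model)] -/
theorem invasion_add_eq_iterate (U : Sym2 V → ℝ) (o : V) (m : ℕ) : ∀ n, invasion G U o (m + n) = (step G U)^[n] (invasion G U o m)
  | 0 => by simp
  | n + 1 => by
    rw [← Nat.add_assoc, invasion_succ, invasion_add_eq_iterate U o m n, Function.iterate_succ_apply']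

/-- **THE MIRROR LEMMA.**  Let `D` be a finite vertex set all of whose bonds to the outside have label `≥ t`, disjoint from `A`, and suppose the invasion-type iteration
from `A` absorbs darts of label `< t` during its first `N` steps (injective labels).  Then prefixing `D` changes nothing: `step^[n] (D ∪ A) = D ∪ step^[n] A` for
`n ≤ N`, with the same absorbed darts for `n < N`. [cite: LyonsPeresSchramm2006, Prop. 3.4 (proof: "I(x) = C(x) ∪ {e} ∪ I(y)")] -/
theorem iterate_step_union {U : Sym2 V → ℝ} (hU : Function.Injective U) {D A : Finset V} {t : ℝ}
    (hD : ∀ d ∈ D, ∀ w, w ∉ D → G.Adj d w → t ≤ U s(d, w)) (hDA : Disjoint D A) {N : ℕ}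
    (hA : ∀ n < N, ∃ b, newDart G U ((step G U)^[n] A) = some b ∧ U s(b.1, b.2) < t) :
    ∀ n, n ≤ N → (step G U)^[n] (D ∪ A) = D ∪ (step G U)^[n] A ∧ Disjoint D ((step G U)^[n] A) ∧
      (n < N → newDart G U (D ∪ (step G U)^[n] A) = newDart G U ((step G U)^[n] A)) := by
  -- the dart comparison at a state `D ∪ B` with `B`'s dart of label `< t`
  have key : ∀ B : Finset V, Disjoint D B → ∀ b, newDart G U B = some b → U s(b.1, b.2) < t →
      newDart G U (D ∪ B) = some b ∧ b.2 ∉ D := by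
    intro B hDB b hb hbt
    have hbmin := newDart_mem G hb
    obtain ⟨hbB, hble⟩ := (mem_minDarts G).1 hbmin
    obtain ⟨hb1, hb2, hbadj⟩ := (mem_boundaryDarts G).1 hbB
    have hb2D : b.2 ∉ D := by
      intro h2
      have := hD b.2 h2 b.1 (fun h1 => Finset.disjoint_left.1 hDB h1 hb1) hbadj.symm
      rw [Sym2.eq_swap] at this
      exact absurd hbt (not_lt.2 this)
    refine ⟨newDart_eq_some_of_mem_minDarts hU.injOn ((mem_minDarts G).2 ⟨?_, fun b' hb' => ?_⟩), hb2D⟩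
    · exact (mem_boundaryDarts G).2 ⟨mem_union_right _ hb1, by rw [mem_union, not_or]; exact ⟨hb2D, hb2⟩, hbadj⟩
    · obtain ⟨hb'1, hb'2, hb'adj⟩ := (mem_boundaryDarts G).1 hb'
      rw [mem_union, not_or] at hb'2
      rcases mem_union.1 hb'1 with h1 | h1
      · exact hbt.le.trans (hD b'.1 h1 b'.2 hb'2.1 hb'adj)
      · exact hble b' ((mem_boundaryDarts G).2 ⟨h1, hb'2.2, hb'adj⟩)
  intro n
  induction n with
  | zero =>
    intro _
    refine ⟨rfl, hDA, fun hN => ?_⟩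
    obtain ⟨b, hb, hbt⟩ := hA 0 hN
    rw [Function.iterate_zero, id_eq] at hb ⊢
    rw [(key A hDA b hb hbt).1, hb]
  | succ n ih =>
    intro hn
    obtain ⟨heq, hdisj, hdart⟩ := ih (Nat.le_of_succ_le hn)
    obtain ⟨b, hb, hbt⟩ := hA n (Nat.lt_of_succ_le hn)
    obtain ⟨hbD, hb2D⟩ := key _ hdisj b hb hbt
    have hstep : (step G U)^[n + 1] (D ∪ A) = D ∪ (step G U)^[n + 1] A := by
      rw [Function.iterate_succ_apply', Function.iterate_succ_apply', heq, step_of_eq_some G hbD, step_of_eq_some G hb, Finset.union_insert]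
    have hdisj' : Disjoint D ((step G U)^[n + 1] A) := by
      rw [Function.iterate_succ_apply', step_of_eq_some G hb, Finset.disjoint_insert_right]
      exact ⟨hb2D, hdisj⟩
    refine ⟨hstep, hdisj', fun hN => ?_⟩
    obtain ⟨b', hb', hbt'⟩ := hA (n + 1) hN
    rw [(key _ hdisj' b' hb' hbt').1, hb']

/-- **Merge**: once two invasions have the same invaded set, they coincide forever (same sets, same absorbed darts). [cite: LyonsPeresSchramm2006, Prop. 3.4 (proof)] -/
theorem invasion_eq_of_eq {U : Sym2 V → ℝ} {x y : V} {m m' : ℕ} (h : invasion G U x m = invasion G U y m') (n : ℕ) :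
    invasion G U x (m + n) = invasion G U y (m' + n) := by
  rw [invasion_add_eq_iterate, invasion_add_eq_iterate, h]

/-! ## §3 LPS06 Proposition 3.4 (tree form) for the endpoints of a WMSF bond -/

/-- If `e = s(x, y)` is the strictly least boundary bond of a finite `W ∋ x` (`y ∉ W`), then the strict cluster `C_{<U e}(x)` lies in `W` (so it is finite and misses `y`).
[cite: LyonsPeresSchramm2006, Prop. 3.4 (proof: "Not both C(x) and C(y) can be infinite, since e ∈ 𝔉_w")] -/
theorem ltCluster_subset_of_least_boundary {U : Sym2 V → ℝ} {W : Finset V} {x y : V} (hx : x ∈ W)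
    (hmin : ∀ b ∈ boundaryDarts G W, s(b.1, b.2) ≠ s(x, y) → U s(x, y) < U s(b.1, b.2)) :
    openCluster {f : Sym2 V | f ∈ G.edgeSet ∧ U f < U s(x, y)} x ⊆ ↑W := by
  intro v hv
  by_contra hvW
  obtain ⟨b, hb, hadj⟩ := exists_boundaryDart_of_reachable (openGraph_ltCfg_le U (U s(x, y))) hv hx (fun h => hvW (Finset.mem_coe.2 h))
  have hlt : U s(b.1, b.2) < U s(x, y) := ((openGraph_adj _ _ _).1 hadj).1.2
  by_cases hbe : s(b.1, b.2) = s(x, y)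
  · rw [hbe] at hlt; exact lt_irrefl _ hlt
  · exact absurd (hmin b hb hbe) (not_lt.2 hlt.le)

/-- **Case "`C(y)` infinite"**: `T(y) ⊆ T(x)` and `T(x) ∖ T(y)` consists of bonds absorbed by `x` up to the exit time `c` — so `T(x) △ T(y)` is finite.  (Injective labels;
`C_{<U e}(x)` finite of size `c + 1`, `y ∉ C_{<U e}(x)`, `C_{<U e}(y)` infinite.) [cite: LyonsPeresSchramm2006, Prop. 3.4 (proof: "I(x) = C(x) ∪ {e} ∪ I(y)")] -/
theorem treeEdges_of_ltCluster_infinite [Infinite V] (hG : G.Preconnected) {U : Sym2 V → ℝ} (hU : Function.Injective U) {x y : V} (hxy : G.Adj x y)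
    (hyx : y ∉ openCluster {f : Sym2 V | f ∈ G.edgeSet ∧ U f < U s(x, y)} x) {c : ℕ}
    (hfin : (openCluster {f : Sym2 V | f ∈ G.edgeSet ∧ U f < U s(x, y)} x).Finite) (hcard : hfin.toFinset.card = c + 1)
    (hinf : (openCluster {f : Sym2 V | f ∈ G.edgeSet ∧ U f < U s(x, y)} y).Infinite) :
    (∀ n, invasion G U x (c + 1 + n) = invasion G U x c ∪ invasion G U y n ∧
      newDart G U (invasion G U x (c + 1 + n)) = newDart G U (invasion G U y n)) ∧
    treeEdges G U y ⊆ treeEdges G U x ∧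
    (treeEdges G U x \ treeEdges G U y ⊆ {e | ∃ k, k ≤ c ∧ ∃ a : V × V, newDart G U (invasion G U x k) = some a ∧ s(a.1, a.2) = e}) := by
  have hI := coe_invasion_eq_ltCluster hG hfin hcard
  have hexit := newDart_ltCluster_exit hG hU hxy hyx hfin hcard
  -- `y`'s invasion only ever accepts labels `< U e`
  have hylt : ∀ n, ∃ b, newDart G U (invasion G U y n) = some b ∧ U s(b.1, b.2) < U s(x, y) := by
    intro n
    obtain ⟨b, hb⟩ := exists_newDart_eq_some (U := U) (boundaryDarts_invasion_nonempty hG U y n)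
    obtain ⟨v, hv, hvI⟩ : ∃ v ∈ openCluster {f : Sym2 V | f ∈ G.edgeSet ∧ U f < U s(x, y)} y, v ∉ invasion G U y n := by
      by_contra h
      push Not at h
      exact hinf ((invasion G U y n).finite_toSet.subset fun v hv => Finset.mem_coe.2 (h v hv))
    refine ⟨b, hb, ?_⟩
    rw [← acceptedLabel_of_eq_some G hb]
    exact acceptedLabel_lt_of_ltCluster_not_subset (root_mem_invasion U y n) hv hvI
  -- mirror lemma with `D = I_c(x) = C(x)` and the process from `{y}`
  have hD : ∀ d ∈ invasion G U x c, ∀ w, w ∉ invasion G U x c → G.Adj d w → U s(x, y) ≤ U s(d, w) := by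
    intro d hd w hw hadj
    exact le_label_of_mem_ltCluster_of_not_mem (hI ▸ Finset.mem_coe.2 hd) (fun h => hw (Finset.mem_coe.1 (hI.symm ▸ h))) hadj
  have hDA : Disjoint (invasion G U x c) (invasion G U y 0) := by
    rw [invasion_zero, Finset.disjoint_singleton_right]
    exact fun h => hyx (hI ▸ Finset.mem_coe.2 h)
  have hiter : ∀ n, (step G U)^[n] (invasion G U y 0) = invasion G U y n := fun n => by
    have := invasion_add_eq_iterate (G := G) U y 0 n
    rw [Nat.zero_add] at this
    exact this.symm
  have hmirror : ∀ n, invasion G U x (c + 1 + n) = invasion G U x c ∪ invasion G U y n ∧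
      newDart G U (invasion G U x (c + 1 + n)) = newDart G U (invasion G U y n) := by
    intro n
    have hA : ∀ k < n + 1, ∃ b, newDart G U ((step G U)^[k] (invasion G U y 0)) = some b ∧ U s(b.1, b.2) < U s(x, y) := fun k _ => by
      rw [hiter]; exact hylt k
    obtain ⟨heq, -, hdart⟩ := iterate_step_union hU hD hDA hA n (Nat.le_succ n)
    rw [hiter] at heq hdart
    have hstart : invasion G U x (c + 1) = invasion G U x c ∪ invasion G U y 0 := by
      rw [invasion_succ_of_newDart hexit, invasion_zero, Finset.union_comm, ← Finset.insert_eq]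
    have hxn : invasion G U x (c + 1 + n) = invasion G U x c ∪ invasion G U y n := by
      rw [invasion_add_eq_iterate, hstart, heq]
    exact ⟨hxn, by rw [hxn]; exact hdart (Nat.lt_succ_self n)⟩
  refine ⟨hmirror, fun e he => ?_, fun e he => ?_⟩
  · obtain ⟨n, a, ha, hae⟩ := (mem_treeEdges G).1 he
    exact (mem_treeEdges G).2 ⟨c + 1 + n, a, by rw [(hmirror n).2]; exact ha, hae⟩
  · obtain ⟨k, a, ha, hae⟩ := (mem_treeEdges G).1 he.1
    have hne := he.2
    refine ⟨k, ?_, a, ha, hae⟩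
    by_contra hk
    push Not at hk
    obtain ⟨n, rfl⟩ : ∃ n, k = c + 1 + n := ⟨k - (c + 1), by omega⟩
    rw [(hmirror n).2] at ha
    exact hne ((mem_treeEdges G).2 ⟨n, a, ha, hae⟩)

end General

end Summit.CriticalPhenomena.PercolationContinuityZ3.Theorems.Rsw3
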